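import Literature.MathematicalPhysics.QuantumFieldTheory.Balaban1983to89.B9GradViaDivLettersSmooth
import Literature.MathematicalPhysics.QuantumFieldTheory.Balaban1983to89.B9SmoothHolderClassSReadings
import Literature.MathematicalPhysics.QuantumFieldTheory.Balaban1983to89.B9MultiscaleSmoothPartitionYNear

/-!
# `Balaban1983to89.B9SmoothHolderLettersOfMem` — THE TWO SMOOTH-CLASS LETTERS OF ROWS 20–21 WITH THE ENLARGEMENT RADIUS DISCHARGED (n06-w6's LAYER B
# `dist_sIK_le_of_nearY`) AND, FOR SU(N) LINKS, THE CONTRACTING-LINKS BINDER DISCHARGED FROM MEMBERSHIP (`_of_mem`, R-generic): `hX` at the pin `bXH := bHZ` and the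
# kinematic letter `J_μ(U) : bHZ → bHZK`, each with ONE displayed analytic binder left (`hΘ`, the small-gauge Hölder datum of `U`) or none

T. Bałaban, *Propagators for lattice gauge theories in a background field*, Commun. Math. Phys. **99** (1985) 389–434
[`Balaban1985BackgroundPropagators`, "B9"]; [4] = T. Bałaban, *Propagators and renormalization transformations for lattice gauge
theories. II*, Commun. Math. Phys. **96** (1984) 223–250 [`Balaban1984PropagatorsII`].

statement-level skeleton of published theorems with citation tags; proofs where landed; nothing here is a claim about the
Yang–Mills mass gap

THE PRINTED LOCI.  [B9] (3.3) p. 390, (3.35) p. 396 (*"U with values in G"* and the small-field class), (3.41)–(3.45) pp. 397–398; [4] (2.46) p. 231, (2.51)–(2.54) p. 232.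

WHY THIS FILE (cell `pub-ymgap`, node N06, seat dag-n06-l g20; eighth piece of the (F1) programme).  `B9SmoothHolderClassSReadings.hasMaj_id_bHZ_cNorm` (the class axiom `hX`
at the pin) and `B9GradViaDivLettersSmooth.hasMaj_JcoKH_smooth` (the letter `J_μ`) display the enlargement radius `hN : NearY i y z → d(y, sIK bI z) ≤ r`; n06-w6's
`B9MultiscaleSmoothPartitionYNear.dist_sIK_le_of_nearY` IS that binder with `r := rNear d ℓ + 1` under the certificate's 1-faithfulness pin `hβ1`.  THIS FILE substitutes it:
* §1 ★ `hasMaj_id_bHZ_cNorm_near` (constant `L·e^{δ(rNear+1)}`) and ★★ `hasMaj_JcoKH_smooth_near` (constant `cR39·CJZ·e^{δ·rZ d ℓ (rNear+1)}`) — every `𝔸`, contracting links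
  `hU` displayed;
* §2 for `𝔸 = M_N(ℂ)`, `G = SU(N)`: ★★ `hasMaj_JcoKH_smooth_of_mem` — the contracting-links binder from MEMBERSHIP `U_μ(z) ∈ SU(N)` (`specialUnitaryUnits_le_U1`; the CASCADE-R `_of_mem`
  currency of dag-n06-w5's `…AtPinsR`: background-generic `(B, rd)`), leaving the ξ-scale small-gauge Hölder datum `hΘ` as the ONLY displayed analytic binder of the letter.
HONEST SCOPE.  One-line substitutions into landed theorems; `hΘ` stays displayed and gauge-VARIANT (flat classes — GAUGE-VARIANCE-MEMO); nothing of [B9]∕[4] asserted; no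
certificate edit; COUNT-NEUTRAL; N06 NOT discharged; nothing continuum, nothing about the mass gap.  Cell `pub-ymgap` (HUMAN RULING D-0062), Track A node N06 [B9], seat
`pub-ymgap-dag-n06-l` (g20), 2026-08-28.
-/

noncomputable section

namespace Literature.MathematicalPhysics.QuantumFieldTheory.Balaban1983to89.B9SmoothHolderLettersOfMem

open scoped Matrix.Norms.L2Operator
open B6Geom246MultiLevelTorus (geomT)
open B6GlobalChartV1 (PV blkV1)
open B6Ineq2142KLevelV1 (β lvl)
open B6KLevelCensusIndexV1 (KIdx Adm tpar)
open B6Prop22KLevelTorusCensusEta (nKT)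
open B7Prop2SpecialUnitary (specialUnitaryUnits specialUnitaryUnits_le_U1)
open B9GeoNormsKLevelV1 (geo9K)
open B9Thm34Ext (toB6)
open B9Thm39ReadingCoords (cR39)
open B11SectG (HasMaj)
open B9Thm312Whole (cNorm)
open B9CoReadingCoordsS (XSK sIK blkSK)
open B9GradViaDivLettersAtPins (JcoKH)
open B9MultiscaleSmoothPartitionY (NearY)
open B9MultiscaleSmoothPartitionYNear (rNear dist_sIK_le_of_nearY)
open B9SmoothHolderClassS (bHZ)
open B9SmoothHolderClassK (bHZK)
open B9SmoothHolderClassSReadings (hasMaj_id_bHZ_cNorm)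
open B9GradViaDivLettersSmoothTerms (CJZ rZ)
open B9GradViaDivLettersSmooth (hasMaj_JcoKH_smooth)
open Node00 (SiteY FBondY IBondY CfgY toKT)

variable {d ℓ : ℕ} {hd : 1 ≤ d + 1} {hL : Odd (ℓ + 1) ∧ 1 < ℓ + 1} {b₀ b₁ : ℝ}
variable (i : KIdx d ℓ hd hL b₀ b₁) [Fintype (geo9K i).Site]
variable {κ : Type} [Fintype κ]

/-! ## §1 The enlargement radius discharged (LAYER B) -/

section Near

variable {𝔸 : Type} [NormedRing 𝔸] [NormedAlgebra ℂ 𝔸] [CompleteSpace 𝔸]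
variable (b : Module.Basis κ ℝ 𝔸) [FiniteDimensional ℝ 𝔸] (B : B9.Backgrounds) (cfg : B.Cfg → CfgY 𝔸 i)
variable {bI : FBondY i → IBondY i}

/-- ★ **`hX` AT THE PIN WITH THE RADIUS DISCHARGED**: `HasMaj (bHZ ε p) (𝔠⁽¹⁾ over blkSK (sIK bI)) id (L·e^{δ(rNear+1)}·e^{−δd})` for `p ≥ 1`, a level- and 1-faithful `bI`
(certificate binders `hlev`, `hβ1`) and `|c_f| ≤ Lᵏ`. [cite: Balaban1985BackgroundPropagators, (3.41)–(3.42) p.397 + (3.44) p.398; Balaban1984PropagatorsII, (2.46) p.231 + (2.51)–(2.54) p.232] -/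
theorem hasMaj_id_bHZ_cNorm_near {R : ℝ} {H : Prop} {ε p : ℝ} (hε0 : 0 ≤ ε) (hε1 : ε ≤ 1) (hεp : ε ≤ p) (h1p : 1 ≤ p)
    (hlen : ∀ y : (geo9K i).Site, 0 ≤ (geo9K i).len y)
    (hlev : ∀ f : FBondY i, lvl i.hN i.D i.hk (bI f) = (blkV1 i.hN i.D f).1.1)
    (hβ1 : ∀ f : FBondY i, (geomT i.D).dist (β i.hN i.D i.hk (bI f)) (blkV1 i.hN i.D f) ≤ 1)
    {δ : ℝ} (hδ : 0 ≤ δ) (hcf : |i.cf| ≤ (nKT (toKT i) : ℝ)) :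
    HasMaj (bHZ (κ := κ) i (R := R) (H := H) hε0 hε1 hεp) (cNorm R H (blkSK i (sIK i bI)) hlen 1) LinearMap.id
      (fun y y' => (((ℓ + 1 : ℕ) : ℝ)) * Real.exp (δ * (rNear d ℓ + 1)) * Real.exp (-(δ * (geo9K i).dist y y'))) :=
  hasMaj_id_bHZ_cNorm i hε0 hε1 hεp h1p hlen hlev hδ (fun _ _ h => dist_sIK_le_of_nearY i hβ1 h) hcf

/-- ★★ **THE KINEMATIC LETTER `J_μ(U)` BETWEEN THE SMOOTH CLASSES WITH THE RADIUS DISCHARGED**: constant `cR39·CJZ ℓ p ϑ·e^{δ·rZ d ℓ (rNear+1)}`, under the certificate's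
`hβ1 ∕ hbI0`, contracting links `hU` and the displayed ξ-scale small-gauge binder `hΘ`. [cite: Balaban1985BackgroundPropagators, (3.3) p.390 + (3.35) p.396 + (3.40) p.397 + (3.43)–(3.45) p.398; Balaban1984PropagatorsII, (2.46) p.231 + (2.137) p.247] -/
theorem hasMaj_JcoKH_smooth_near {R : ℝ} {H : Prop} {ε p : ℝ} (hε0 : 0 ≤ ε) (hε1 : ε ≤ 1) (hεp : ε ≤ p)
    (hβ1 : ∀ f : FBondY i, (geomT i.D).dist (β i.hN i.D i.hk (bI f)) (blkV1 i.hN i.D f) ≤ 1)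
    (hbI0 : ∀ f : FBondY i, bI f = bI ⟨f.src, 0⟩) {U₁ : B.Cfg}
    (hU : ∀ (ν : Fin (d + 1)) (s : Site (PV d ℓ i.m i.K hd hL) 0), ‖(cfg U₁ ν s : 𝔸)‖ ≤ 1 ∧ ‖(((cfg U₁ ν s)⁻¹ : 𝔸ˣ) : 𝔸)‖ ≤ 1)
    {ϑ : ℝ} (hϑ : 0 ≤ ϑ)
    (hΘ : ∀ (μ : Fin (d + 1)) (s s' : Site (PV d ℓ i.m i.K hd hL) 0), Adm i ⟨s, μ⟩ ⟨s', μ⟩ →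
      tpar i ⟨s, μ⟩ ⟨s', μ⟩ ^ (-ε) * ‖(cfg U₁ μ s : 𝔸) - (cfg U₁ μ s' : 𝔸)‖ ≤ ϑ)
    {δ : ℝ} (hδ : 0 ≤ δ) (μ : Fin (d + 1)) :
    HasMaj (bHZ (κ := κ) i (R := R) (H := H) hε0 hε1 hεp) (bHZK (κ := κ) i (R := R) (H := H) hε0 hε1 hεp) (JcoKH i b B cfg μ U₁)
      (fun y y' => cR39 b * CJZ ℓ p ϑ * Real.exp (δ * rZ d ℓ (rNear d ℓ + 1)) * Real.exp (-(δ * (geo9K i).dist y y'))) :=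
  hasMaj_JcoKH_smooth i b B cfg hε0 hε1 hεp hβ1 hbI0 hU hϑ hΘ (fun _ _ h => dist_sIK_le_of_nearY i hβ1 h) hδ μ

end Near

/-! ## §2 SU(N) links: contracting links from membership (the CASCADE-R `_of_mem` currency) -/

section Mem

variable {N : ℕ} [NeZero N] (b : Module.Basis κ ℝ (Matrix (Fin N) (Fin N) ℂ)) (B : B9.Backgrounds) (rd : B.Cfg → CfgY (Matrix (Fin N) (Fin N) ℂ) i)
variable {bI : FBondY i → IBondY i}

/-- ★★ **THE KINEMATIC LETTER `J_μ(U)` BETWEEN THE SMOOTH CLASSES FOR SU(N)-VALUED LINKS** (background-generic `(B, rd)`; links contracting because `U_μ(z) ∈ SU(N)` —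
`specialUnitaryUnits_le_U1` — not because of (3.35)'s smallness): the ONLY displayed analytic binder is the ξ-scale small-gauge Hölder datum `hΘ`.
[cite: Balaban1985BackgroundPropagators, (3.3) p.390 + (3.35) p.396 («U with values in G») + (3.40) p.397 + (3.43)–(3.45) p.398; Balaban1984PropagatorsII, (2.46) p.231 + (2.137) p.247] -/
theorem hasMaj_JcoKH_smooth_of_mem {R : ℝ} {H : Prop} {ε p : ℝ} (hε0 : 0 ≤ ε) (hε1 : ε ≤ 1) (hεp : ε ≤ p)
    (hβ1 : ∀ f : FBondY i, (geomT i.D).dist (β i.hN i.D i.hk (bI f)) (blkV1 i.hN i.D f) ≤ 1)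
    (hbI0 : ∀ f : FBondY i, bI f = bI ⟨f.src, 0⟩) {U₁ : B.Cfg}
    (hUG : ∀ (ν : Fin (d + 1)) (s : Site (PV d ℓ i.m i.K hd hL) 0), rd U₁ ν s ∈ specialUnitaryUnits (Fin N))
    {ϑ : ℝ} (hϑ : 0 ≤ ϑ)
    (hΘ : ∀ (μ : Fin (d + 1)) (s s' : Site (PV d ℓ i.m i.K hd hL) 0), Adm i ⟨s, μ⟩ ⟨s', μ⟩ →
      tpar i ⟨s, μ⟩ ⟨s', μ⟩ ^ (-ε) * ‖(rd U₁ μ s : Matrix (Fin N) (Fin N) ℂ) - (rd U₁ μ s' : Matrix (Fin N) (Fin N) ℂ)‖ ≤ ϑ)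
    {δ : ℝ} (hδ : 0 ≤ δ) (μ : Fin (d + 1)) :
    HasMaj (bHZ (κ := κ) i (R := R) (H := H) hε0 hε1 hεp) (bHZK (κ := κ) i (R := R) (H := H) hε0 hε1 hεp) (JcoKH i b B rd μ U₁)
      (fun y y' => cR39 b * CJZ ℓ p ϑ * Real.exp (δ * rZ d ℓ (rNear d ℓ + 1)) * Real.exp (-(δ * (geo9K i).dist y y'))) :=
  hasMaj_JcoKH_smooth_near i b B rd hε0 hε1 hεp hβ1 hbI0 (fun ν s => specialUnitaryUnits_le_U1 (hUG ν s)) hϑ hΘ hδ μ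

end Mem

end Literature.MathematicalPhysics.QuantumFieldTheory.Balaban1983to89.B9SmoothHolderLettersOfMem
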